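import Literature.NumberTheory.Automorphic.UnipotentColumnRange
import HarnessLib

/-!
# Splitting a column-range unipotent group along a column: `U_{[a,b]} = U_{[m+1,b]} · U_{[a,m]}`,
and the Haar measure of `U_{[a,b]}(𝔸_K)` as a product

Topic `NumberTheory/Automorphic`; namespace `Literature.NumberTheory.Automorphic`. Sequel to
`UnipotentColumnRange`. For the column-range groups `U_{[a,b]} ≤ N_n` (entries above the diagonal
only in the columns `a, …, b`) and any `m`:

* `colSplitHigh`, `colSplitLow`, `colSplit_mul` — **every `u ∈ U_{[a,b]}` is uniquely `u = h ℓ` with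
  `h ∈ U_{[m+1,b]}`, `ℓ ∈ U_{[a,m]}`, and the entries are simply copied**: `(h ℓ)_{ij} = ℓ_{ij}` in the
  columns `j ≤ m` and `= h_{ij}` in the columns `j > m` (`mul_apply_of_colSplit`). Over the adeles this
  is a homeomorphism `colSplitHomeomorph : U_{[m+1,b]}(𝔸_K) × U_{[a,m]}(𝔸_K) ≃ₜ U_{[a,b]}(𝔸_K)`, and it
  maps the product of the Tate boxes onto the Tate box (`image_colSplitHomeomorph_prod`).
* `U_{[m+1,b]}` is normalised by `U_{[a,m]}` (`conj_mem_colRangeHigh`: it is the unipotent radical of a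
  parabolic of the ambient `GL_{b+1}`-corner).
* `isHaarMeasure_map_colSplitHomeomorph` — **the image of `μ_H ⊗ μ_L` under `(h, ℓ) ↦ h ℓ` is a Haar
  measure on `U_{[a,b]}(𝔸_K)`** for Haar measures `μ_H`, `μ_L` of the factors. Proof: in the *other*
  order `(ℓ, h) ↦ ℓ h` this is the Haar measure of an internal semidirect product (left translation by
  `ℓ₀` is `(ℓ, h) ↦ (ℓ₀ ℓ, h)`, by `h₀` the skew product `(ℓ, h) ↦ (ℓ, (ℓ⁻¹ h₀ ℓ) h)`; the argument of
  `SemidirectHaar`, reproduced for these concrete groups to avoid iterated subtypes), and the two orders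
  give the same measure because all three groups are unimodular, hence their Haar measures are
  inversion invariant (`UnipotentColumnRange`): `(ℓ h)⁻¹ = h⁻¹ ℓ⁻¹`.
* `lintegral_adelicColRange_eq_mul_lintegral_prod` (and `…_swap`, the order `ℓ h`) — hence **`∫_{U_{[a,b]}} f dν = c ∫_{U_{[m+1,b]}} ∫_{U_{[a,m]}}
  f(h ℓ) dμ_L dμ_H`** (and in the other order) for every Haar measure `ν`, with `c ∈ (0, ∞)`; and
  `measure_colRangeTateDomain_eq_mul` — `ν(box_{[a,b]}) = c μ_H(box_{[m+1,b]}) μ_L(box_{[a,m]})`.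

These are the bookkeeping identities behind "`dn = ∏_{i<j} dn_{ij}`" for the unfolding of the
Rankin–Selberg integral along `N_n ⊃ U^{(2)} ⊃ ⋯` (Jacquet–Shalika (1981), §4; Cogdell (2004), §1.1,
§2.3), obtained here without coordinates. Everything is proved.

## References

* J. W. Cogdell, *Analytic theory of L-functions for GL_n*, in *An Introduction to the Langlands
  Program* (2004), §1.1, §2.3 [CogdellAnalyticTheory2004].
* N. Bourbaki, *Intégration*, Ch. VII, §2, no. 9 (Haar measure of a semidirect product).
-/

noncomputable section

open MeasureTheory Measure NumberField IsDedekindDomain Matrix Set Filter Topology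
open scoped MatrixGroups ENNReal NNReal Pointwise

namespace Literature.NumberTheory.Automorphic

/-! ### The algebraic splitting over a commutative ring -/

section Ring

variable {n : ℕ} {R : Type*} [CommRing R] {a b : ℕ} (m : ℕ)

/-- **Entries of a product `h ℓ` with `h ∈ U_{[m+1,b']}`, `ℓ ∈ U_{[a',m]}` are copied**:
`(h ℓ)_{ij} = ℓ_{ij}` if `j ≤ m` and `= h_{ij}` if `m < j` (for *all* `i, j`). In a column `j ≤ m`,
`h_{ik} ℓ_{kj}` vanishes unless `k = i` (`h_{ik} ≠ 0` forces `k = i` or `k > m ≥ j`, and then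
`ℓ_{kj} = 0` below the diagonal); in a column `j > m`, `ℓ_{kj} = δ_{kj}`. [folklore] -/
theorem mul_apply_of_colRange {a' b' : ℕ} {h ℓ : GL (Fin n) R} (hh : h ∈ unipotentColRange n R (m + 1) b')
    (hℓ : ℓ ∈ unipotentColRange n R a' m) (i j : Fin n) :
    ((h * ℓ : GL (Fin n) R) : Matrix (Fin n) (Fin n) R) i j =
      if (j : ℕ) ≤ m then (ℓ : Matrix (Fin n) (Fin n) R) i j else (h : Matrix (Fin n) (Fin n) R) i j := by
  rw [Units.val_mul, Matrix.mul_apply]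
  split_ifs with hjm
  · -- column `j ≤ m`: only `k = i` contributes
    rw [Finset.sum_eq_single i]
    · rw [apply_of_le hh le_rfl, if_pos rfl, one_mul]
    · intro k _ hki
      by_cases hik : i < k
      · -- `h_{ik} ≠ 0` needs the column `k` in `[m+1, b']`, so `k > m ≥ j` and `ℓ_{kj} = 0`
        by_cases hk : InColRange n (m + 1) b' k
        · have hkj : j < k := by
            have := hk.1
            exact Fin.lt_def.2 (by omega)
          rw [apply_of_le hℓ hkj.le, if_neg (ne_of_gt hkj), mul_zero]
        · rw [hh.2 i k (ne_of_lt hik) hk, zero_mul]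
      · have hki' : k < i := lt_of_le_of_ne (not_lt.1 hik) hki
        rw [apply_of_le hh hki'.le, if_neg (ne_of_gt hki'), zero_mul]
    · intro hi; exact (hi (Finset.mem_univ i)).elim
  · -- column `j > m`: `ℓ_{kj} = δ_{kj}`
    have hcol : ∀ k, (ℓ : Matrix (Fin n) (Fin n) R) k j = if k = j then 1 else 0 :=
      fun k => apply_of_not_inColRange hℓ k fun hk => hjm hk.2
    simp only [hcol, mul_ite, mul_one, mul_zero, Finset.sum_ite_eq', Finset.mem_univ, if_true]

/-- The entries of `u ∈ U_{[a,b]}` in the high columns, as a family. [folklore] -/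
def highEntries (u : GL (Fin n) R) (i j : Fin n) : R :=
  if m < (j : ℕ) then (u : Matrix (Fin n) (Fin n) R) i j else 0

/-- The entries of `u ∈ U_{[a,b]}` in the low columns, as a family. [folklore] -/
def lowEntries (u : GL (Fin n) R) (i j : Fin n) : R :=
  if (j : ℕ) ≤ m then (u : Matrix (Fin n) (Fin n) R) i j else 0

/-- **The high part** `h ∈ U_{[m+1,b]}` of `u ∈ U_{[a,b]}`: keep the columns `> m`. [folklore] -/
def colSplitHigh (u : GL (Fin n) R) : GL (Fin n) R :=
  unitriangularGL (highEntries m u)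

/-- **The low part** `ℓ ∈ U_{[a,m]}` of `u ∈ U_{[a,b]}`: keep the columns `≤ m`. [folklore] -/
def colSplitLow (u : GL (Fin n) R) : GL (Fin n) R :=
  unitriangularGL (lowEntries m u)

/-- Entries of the high part above the diagonal. [folklore] -/
theorem colSplitHigh_apply_of_lt (u : GL (Fin n) R) {i j : Fin n} (hij : i < j) :
    ((colSplitHigh m u : GL (Fin n) R) : Matrix (Fin n) (Fin n) R) i j =
      if m < (j : ℕ) then (u : Matrix (Fin n) (Fin n) R) i j else 0 := by
  rw [colSplitHigh, coe_unitriangularGL, unitriangularOfEntries_apply, if_neg (ne_of_lt hij), if_pos hij]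
  rfl

/-- Entries of the low part above the diagonal. [folklore] -/
theorem colSplitLow_apply_of_lt (u : GL (Fin n) R) {i j : Fin n} (hij : i < j) :
    ((colSplitLow m u : GL (Fin n) R) : Matrix (Fin n) (Fin n) R) i j =
      if (j : ℕ) ≤ m then (u : Matrix (Fin n) (Fin n) R) i j else 0 := by
  rw [colSplitLow, coe_unitriangularGL, unitriangularOfEntries_apply, if_neg (ne_of_lt hij), if_pos hij]
  rfl

/-- The high part lies in `U_{[m+1,b]}`. [folklore] -/
theorem colSplitHigh_mem {u : GL (Fin n) R} (hu : u ∈ unipotentColRange n R a b) :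
    colSplitHigh m u ∈ unipotentColRange n R (m + 1) b := by
  refine mem_unipotentColRange_of (unitriangularGL_mem _) fun i j hij hj => ?_
  rw [colSplitHigh_apply_of_lt m u hij]
  split_ifs with hjm
  · -- `m < j` and `j ∉ [m+1, b]` force `b < j`, outside `[a, b]`
    have hjb : ¬ InColRange n a b j := fun h => hj ⟨hjm, h.2⟩
    exact hu.2 i j (ne_of_lt hij) hjb
  · rfl

/-- The low part lies in `U_{[a,m]}`. [folklore] -/
theorem colSplitLow_mem {u : GL (Fin n) R} (hu : u ∈ unipotentColRange n R a b) :
    colSplitLow m u ∈ unipotentColRange n R a m := by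
  refine mem_unipotentColRange_of (unitriangularGL_mem _) fun i j hij hj => ?_
  rw [colSplitLow_apply_of_lt m u hij]
  split_ifs with hjm
  · have hja : ¬ InColRange n a b j := fun h => hj ⟨h.1, hjm⟩
    exact hu.2 i j (ne_of_lt hij) hja
  · rfl

/-- **The splitting**: `u = (high part) (low part)` for `u ∈ U_{[a,b]}`. [folklore] -/
theorem colSplit_mul {u : GL (Fin n) R} (hu : u ∈ unipotentColRange n R a b) :
    colSplitHigh m u * colSplitLow m u = u := by
  refine Units.ext (Matrix.ext fun i j => ?_)
  rw [mul_apply_of_colRange m (colSplitHigh_mem m hu) (colSplitLow_mem m hu)]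
  obtain ⟨hut, hud⟩ := (mem_upperUnitriangular_iff u).1 hu.1
  rcases lt_trichotomy i j with hij | rfl | hji
  · rw [colSplitLow_apply_of_lt m u hij, colSplitHigh_apply_of_lt m u hij]
    by_cases h1 : (j : ℕ) ≤ m
    · rw [if_pos h1, if_pos h1]
    · rw [if_neg h1, if_pos (lt_of_not_ge h1)]
  · rw [apply_of_le (colSplitLow_mem m hu) le_rfl, apply_of_le (colSplitHigh_mem m hu) le_rfl, hud]
    simp
  · rw [apply_of_le (colSplitLow_mem m hu) hji.le, apply_of_le (colSplitHigh_mem m hu) hji.le, hut hji]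
    simp [if_neg (show i ≠ j from ne_of_gt hji)]

/-- **Uniqueness of the splitting**: if `h ℓ = h' ℓ'` with `h, h' ∈ U_{[m+1,b']}` and
`ℓ, ℓ' ∈ U_{[a',m]}` then `h = h'` and `ℓ = ℓ'` (read off the entries, `mul_apply_of_colRange`).
[folklore] -/
theorem colSplit_unique {a' b' : ℕ} {h h' ℓ ℓ' : GL (Fin n) R}
    (hh : h ∈ unipotentColRange n R (m + 1) b') (hh' : h' ∈ unipotentColRange n R (m + 1) b')
    (hℓ : ℓ ∈ unipotentColRange n R a' m) (hℓ' : ℓ' ∈ unipotentColRange n R a' m)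
    (he : h * ℓ = h' * ℓ') : h = h' ∧ ℓ = ℓ' := by
  have hent : ∀ i j, ((h * ℓ : GL (Fin n) R) : Matrix (Fin n) (Fin n) R) i j =
      ((h' * ℓ' : GL (Fin n) R) : Matrix (Fin n) (Fin n) R) i j := fun i j => by rw [he]
  constructor
  · refine Units.ext (Matrix.ext fun i j => ?_)
    by_cases hjm : (j : ℕ) ≤ m
    · -- column `j ≤ m` is out of range for `h, h'`
      have hj : ¬ InColRange n (m + 1) b' j := fun hk => by have := hk.1; omega
      rw [apply_of_not_inColRange hh i hj, apply_of_not_inColRange hh' i hj]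
    · have := hent i j
      rwa [mul_apply_of_colRange m hh hℓ, mul_apply_of_colRange m hh' hℓ', if_neg hjm, if_neg hjm] at this
  · refine Units.ext (Matrix.ext fun i j => ?_)
    by_cases hjm : (j : ℕ) ≤ m
    · have := hent i j
      rwa [mul_apply_of_colRange m hh hℓ, mul_apply_of_colRange m hh' hℓ', if_pos hjm, if_pos hjm] at this
    · have hj : ¬ InColRange n a' m j := fun hk => hjm hk.2
      rw [apply_of_not_inColRange hℓ i hj, apply_of_not_inColRange hℓ' i hj]

/-- The high part of `h ℓ` is `h`, the low part is `ℓ`. [folklore] -/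
theorem colSplitHigh_mul_colSplitLow_eq {h ℓ : GL (Fin n) R}
    (hh : h ∈ unipotentColRange n R (m + 1) b) (hℓ : ℓ ∈ unipotentColRange n R a m) (hab : a ≤ m + 1)
    (hmb : m ≤ b) :
    colSplitHigh m (h * ℓ) = h ∧ colSplitLow m (h * ℓ) = ℓ := by
  have hu : h * ℓ ∈ unipotentColRange n R a b :=
    (unipotentColRange n R a b).mul_mem (unipotentColRange_mono hab le_rfl hh)
      (unipotentColRange_mono le_rfl hmb hℓ)
  exact colSplit_unique m (colSplitHigh_mem m hu) hh (colSplitLow_mem m hu) hℓ (colSplit_mul m hu)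

/-- **`U_{[m+1,b]}` is normalised by `U_{[a,m]}`**: `ℓ h ℓ⁻¹ ∈ U_{[m+1,b]}` for `h ∈ U_{[m+1,b]}`,
`ℓ ∈ U_{[a,m]}` (the columns `j ≤ m` of `ℓ h` are those of `ℓ`, so those of `ℓ h ℓ⁻¹` are those of
`ℓ ℓ⁻¹ = 1`). [folklore] -/
theorem conj_mem_colRangeHigh {h ℓ : GL (Fin n) R} (hh : h ∈ unipotentColRange n R (m + 1) b)
    (hℓ : ℓ ∈ unipotentColRange n R a m) : ℓ * h * ℓ⁻¹ ∈ unipotentColRange n R (m + 1) b := by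
  have hN : ℓ * h * ℓ⁻¹ ∈ upperUnitriangular (Fin n) R :=
    (upperUnitriangular (Fin n) R).mul_mem ((upperUnitriangular (Fin n) R).mul_mem hℓ.1 hh.1)
      ((upperUnitriangular (Fin n) R).inv_mem hℓ.1)
  refine ⟨hN, fun i j hij hj => ?_⟩
  by_cases hjm : m < (j : ℕ)
  · -- column `j > b`: then also out of range for `h` and `ℓ`, all three factors are trivial there
    have hjb : b < (j : ℕ) := by
      by_contra hle
      exact hj ⟨hjm, not_lt.1 hle⟩
    have hjℓ : ¬ InColRange n a m j := fun hk => by have := hk.2; omega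
    have hcolinv : ∀ k, ((ℓ⁻¹ : GL (Fin n) R) : Matrix (Fin n) (Fin n) R) k j = if k = j then 1 else 0 :=
      fun k => apply_of_not_inColRange ((unipotentColRange n R a m).inv_mem hℓ) k hjℓ
    have hcolh : ∀ k, (h : Matrix (Fin n) (Fin n) R) k j = if k = j then 1 else 0 :=
      fun k => apply_of_not_inColRange hh k hj
    have hcolℓ : ∀ k, (ℓ : Matrix (Fin n) (Fin n) R) k j = if k = j then 1 else 0 :=
      fun k => apply_of_not_inColRange hℓ k hjℓ
    rw [Units.val_mul, Matrix.mul_apply]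
    simp only [hcolinv, mul_ite, mul_one, mul_zero, Finset.sum_ite_eq', Finset.mem_univ, if_true]
    rw [Units.val_mul, Matrix.mul_apply]
    simp only [hcolh, mul_ite, mul_one, mul_zero, Finset.sum_ite_eq', Finset.mem_univ, if_true]
    rw [hcolℓ, if_neg hij]
  · -- column `j ≤ m`: `(ℓ h ℓ⁻¹)_{ij} = (ℓ ℓ⁻¹)_{ij} = δ_{ij}`
    have hjm' : (j : ℕ) ≤ m := not_lt.1 hjm
    -- the columns `k ≤ j` of `ℓ h` agree with those of `ℓ`
    have hcols : ∀ k, k ≤ j → ∀ i', ((ℓ * h : GL (Fin n) R) : Matrix (Fin n) (Fin n) R) i' k =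
        (ℓ : Matrix (Fin n) (Fin n) R) i' k := by
      intro k hkj i'
      have hk : ¬ InColRange n (m + 1) b k := fun hk => by
        have h1 := hk.1; have h2 : (k : ℕ) ≤ (j : ℕ) := hkj; omega
      have hcolk : ∀ l, (h : Matrix (Fin n) (Fin n) R) l k = if l = k then 1 else 0 :=
        fun l => apply_of_not_inColRange hh l hk
      rw [Units.val_mul, Matrix.mul_apply]
      simp only [hcolk, mul_ite, mul_one, mul_zero, Finset.sum_ite_eq', Finset.mem_univ, if_true]
    have hinvt := ((mem_upperUnitriangular_iff _).1 ((upperUnitriangular (Fin n) R).inv_mem hℓ.1)).1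
    calc (((ℓ * h * ℓ⁻¹ : GL (Fin n) R)) : Matrix (Fin n) (Fin n) R) i j
        = ∑ k, ((ℓ * h : GL (Fin n) R) : Matrix (Fin n) (Fin n) R) i k *
            ((ℓ⁻¹ : GL (Fin n) R) : Matrix (Fin n) (Fin n) R) k j := by
          rw [Units.val_mul, Matrix.mul_apply]
      _ = ∑ k, (ℓ : Matrix (Fin n) (Fin n) R) i k * ((ℓ⁻¹ : GL (Fin n) R) : Matrix (Fin n) (Fin n) R) k j := by
          refine Finset.sum_congr rfl fun k _ => ?_
          by_cases hkj : k ≤ j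
          · rw [hcols k hkj i]
          · rw [hinvt (lt_of_not_ge hkj), mul_zero, mul_zero]
      _ = (((ℓ * ℓ⁻¹ : GL (Fin n) R)) : Matrix (Fin n) (Fin n) R) i j := by
          rw [Units.val_mul, Matrix.mul_apply]
      _ = 0 := by rw [mul_inv_cancel, Units.val_one, Matrix.one_apply_ne hij]

end Ring

/-! ### The adelic splitting as a homeomorphism, and the boxes -/

section Adelic

variable {n : ℕ} {K : Type} [Field K] [NumberField K] {a b : ℕ} (m : ℕ)

/-- **The splitting homeomorphism** `U_{[m+1,b]}(𝔸_K) × U_{[a,m]}(𝔸_K) ≃ₜ U_{[a,b]}(𝔸_K)`,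
`(h, ℓ) ↦ h ℓ`, for `a ≤ m + 1`, `m ≤ b` (inverse: the high and low parts; continuity of the
entries). [folklore] -/
def colSplitHomeomorph (hab : a ≤ m + 1) (hmb : m ≤ b) :
    ↥(adelicColRange n K (m + 1) b) × ↥(adelicColRange n K a m) ≃ₜ ↥(adelicColRange n K a b) where
  toFun p := ⟨(p.1 : GL (Fin n) (AdeleRing (𝓞 K) K)) * p.2,
    (adelicColRange n K a b).mul_mem (unipotentColRange_mono hab le_rfl p.1.2)
      (unipotentColRange_mono le_rfl hmb p.2.2)⟩
  invFun u := (⟨colSplitHigh m (u : GL (Fin n) (AdeleRing (𝓞 K) K)), colSplitHigh_mem m u.2⟩,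
    ⟨colSplitLow m (u : GL (Fin n) (AdeleRing (𝓞 K) K)), colSplitLow_mem m u.2⟩)
  left_inv p := by
    obtain ⟨h1, h2⟩ := colSplitHigh_mul_colSplitLow_eq m p.1.2 p.2.2 hab hmb
    exact Prod.ext (Subtype.ext h1) (Subtype.ext h2)
  right_inv u := Subtype.ext (colSplit_mul m u.2)
  continuous_toFun := by
    refine Continuous.subtype_mk ?_ _
    exact (continuous_subtype_val.comp continuous_fst).mul (continuous_subtype_val.comp continuous_snd)
  continuous_invFun := by
    have hval : Continuous fun u : ↥(adelicColRange n K a b) =>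
        ((u : GL (Fin n) (AdeleRing (𝓞 K) K)) : Matrix (Fin n) (Fin n) (AdeleRing (𝓞 K) K)) :=
      Units.continuous_val.comp continuous_subtype_val
    refine Continuous.prodMk (Continuous.subtype_mk ?_ _) (Continuous.subtype_mk ?_ _)
    · change Continuous fun u : ↥(adelicColRange n K a b) =>
        unitriangularGL (highEntries m (u : GL (Fin n) (AdeleRing (𝓞 K) K)))
      refine continuous_unitriangularGL.comp (continuous_pi fun i => continuous_pi fun j => ?_)
      unfold highEntries
      split_ifs
      · exact hval.matrix_elem i j
      · exact continuous_const
    · change Continuous fun u : ↥(adelicColRange n K a b) =>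
        unitriangularGL (lowEntries m (u : GL (Fin n) (AdeleRing (𝓞 K) K)))
      refine continuous_unitriangularGL.comp (continuous_pi fun i => continuous_pi fun j => ?_)
      unfold lowEntries
      split_ifs
      · exact hval.matrix_elem i j
      · exact continuous_const

/-- The underlying matrix of `colSplitHomeomorph m hab hmb (h, ℓ)` is `h ℓ` (definitional). [folklore] -/
@[simp]
theorem coe_colSplitHomeomorph_apply (hab : a ≤ m + 1) (hmb : m ≤ b)
    (p : ↥(adelicColRange n K (m + 1) b) × ↥(adelicColRange n K a m)) :
    ((colSplitHomeomorph (n := n) (K := K) m hab hmb p : ↥(adelicColRange n K a b)) :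
      GL (Fin n) (AdeleRing (𝓞 K) K)) = (p.1 : GL (Fin n) (AdeleRing (𝓞 K) K)) * p.2 := rfl

/-- **The box is the product of the boxes**: `(h, ℓ) ↦ h ℓ` maps `box_{[m+1,b]} × box_{[a,m]}` onto
`box_{[a,b]}` (the entries are copied, `mul_apply_of_colRange`). [folklore] -/
theorem image_colSplitHomeomorph_prod (hab : a ≤ m + 1) (hmb : m ≤ b) :
    colSplitHomeomorph (n := n) (K := K) m hab hmb ''
        (colRangeTateDomain n K (m + 1) b ×ˢ colRangeTateDomain n K a m) =
      colRangeTateDomain n K a b := by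
  ext u
  constructor
  · rintro ⟨⟨h, ℓ⟩, ⟨hh, hℓ⟩, rfl⟩
    intro i j hij
    change (((h : GL (Fin n) (AdeleRing (𝓞 K) K)) * ℓ : GL (Fin n) (AdeleRing (𝓞 K) K)) :
      Matrix (Fin n) (Fin n) (AdeleRing (𝓞 K) K)) i j ∈ _
    rw [mul_apply_of_colRange m h.2 ℓ.2]
    split_ifs
    · exact hℓ i j hij
    · exact hh i j hij
  · intro hu
    refine ⟨(colSplitHomeomorph m hab hmb).symm u, ⟨fun i j hij => ?_, fun i j hij => ?_⟩,
      (colSplitHomeomorph m hab hmb).apply_symm_apply u⟩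
    · change ((colSplitHigh m (u : GL (Fin n) (AdeleRing (𝓞 K) K)) : GL (Fin n) (AdeleRing (𝓞 K) K)) :
        Matrix (Fin n) (Fin n) (AdeleRing (𝓞 K) K)) i j ∈ _
      rw [colSplitHigh_apply_of_lt m _ hij]
      split_ifs
      · exact hu i j hij
      · exact zero_mem_adeleFundamentalDomain K
    · change ((colSplitLow m (u : GL (Fin n) (AdeleRing (𝓞 K) K)) : GL (Fin n) (AdeleRing (𝓞 K) K)) :
        Matrix (Fin n) (Fin n) (AdeleRing (𝓞 K) K)) i j ∈ _
      rw [colSplitLow_apply_of_lt m _ hij]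
      split_ifs
      · exact hu i j hij
      · exact zero_mem_adeleFundamentalDomain K

/-! ### The Haar measure of `U_{[a,b]}(𝔸_K)` in split coordinates -/

section Measure

variable [MeasurableSpace (GL (Fin n) (AdeleRing (𝓞 K) K))] [BorelSpace (GL (Fin n) (AdeleRing (𝓞 K) K))]
variable (hab : a ≤ m + 1) (hmb : m ≤ b)
  (μH : Measure ↥(adelicColRange n K (m + 1) b)) (μL : Measure ↥(adelicColRange n K a m))
  [IsHaarMeasure μH] [IsHaarMeasure μL]

/-- The conjugate `ℓ⁻¹ h₀ ℓ ∈ U_{[m+1,b]}(𝔸_K)` as an element. [folklore] -/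
def lowConj (ℓ : ↥(adelicColRange n K a m)) (h₀ : ↥(adelicColRange n K (m + 1) b)) :
    ↥(adelicColRange n K (m + 1) b) :=
  ⟨(ℓ : GL (Fin n) (AdeleRing (𝓞 K) K))⁻¹ * h₀ * ℓ, by
    have h := conj_mem_colRangeHigh m h₀.2 ((adelicColRange n K a m).inv_mem ℓ.2)
    rwa [inv_inv] at h⟩

omit [MeasurableSpace (GL (Fin n) (AdeleRing (𝓞 K) K))] [BorelSpace (GL (Fin n) (AdeleRing (𝓞 K) K))] in
/-- `ℓ ↦ ℓ⁻¹ h₀ ℓ` is continuous. [folklore] -/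
theorem continuous_lowConj (h₀ : ↥(adelicColRange n K (m + 1) b)) :
    Continuous fun ℓ : ↥(adelicColRange n K a m) => lowConj m ℓ h₀ := by
  refine Continuous.subtype_mk ?_ _
  exact ((continuous_subtype_val.inv).mul continuous_const).mul continuous_subtype_val

/-- **The semidirect order `(ℓ, h) ↦ ℓ h` gives a left-invariant measure**: the image of `μ_L ⊗ μ_H`
under `(ℓ, h) ↦ ℓ h` is left invariant on `U_{[a,b]}(𝔸_K)`. Left translation by `ℓ₀` is
`(ℓ, h) ↦ (ℓ₀ ℓ, h)`; by `h₀` it is the skew product `(ℓ, h) ↦ (ℓ, (ℓ⁻¹ h₀ ℓ) h)` of left translations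
of `U_{[m+1,b]}(𝔸_K)` over `U_{[a,m]}(𝔸_K)` (Mathlib `MeasurePreserving.skew_product`); every element is
`h ℓ = ℓ (ℓ⁻¹ h ℓ)`. (The argument of `SemidirectHaar`, for these concrete groups.) [folklore] -/
theorem isMulLeftInvariant_map_low_mul_high :
    ((μL.prod μH).map fun p : ↥(adelicColRange n K a m) × ↥(adelicColRange n K (m + 1) b) =>
      (⟨(p.1 : GL (Fin n) (AdeleRing (𝓞 K) K)) * p.2,
        (adelicColRange n K a b).mul_mem (unipotentColRange_mono le_rfl hmb p.1.2)
          (unipotentColRange_mono hab le_rfl p.2.2)⟩ : ↥(adelicColRange n K a b))).IsMulLeftInvariant := by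
  set e : ↥(adelicColRange n K a m) × ↥(adelicColRange n K (m + 1) b) → ↥(adelicColRange n K a b) :=
    fun p => ⟨(p.1 : GL (Fin n) (AdeleRing (𝓞 K) K)) * p.2,
      (adelicColRange n K a b).mul_mem (unipotentColRange_mono le_rfl hmb p.1.2)
        (unipotentColRange_mono hab le_rfl p.2.2)⟩ with he_def
  have he : Measurable e := by
    refine (Continuous.subtype_mk ?_ _).measurable
    exact (continuous_subtype_val.comp continuous_fst).mul (continuous_subtype_val.comp continuous_snd)
  -- invariance under the low factor
  have hL : ∀ ℓ₀ : ↥(adelicColRange n K a m),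
      ((μL.prod μH).map e).map ((⟨ℓ₀, unipotentColRange_mono le_rfl hmb ℓ₀.2⟩ :
        ↥(adelicColRange n K a b)) * ·) = (μL.prod μH).map e := by
    intro ℓ₀
    rw [map_map (measurable_const_mul _) he]
    have hcomp : (((⟨ℓ₀, unipotentColRange_mono le_rfl hmb ℓ₀.2⟩ : ↥(adelicColRange n K a b)) * ·) ∘ e) =
        e ∘ fun p => (ℓ₀ * p.1, p.2) := by
      funext p
      refine Subtype.ext ?_
      change (ℓ₀ : GL (Fin n) (AdeleRing (𝓞 K) K)) * ((p.1 : GL (Fin n) (AdeleRing (𝓞 K) K)) * p.2) =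
        (ℓ₀ : GL (Fin n) (AdeleRing (𝓞 K) K)) * p.1 * p.2
      rw [mul_assoc]
    have hmp : MeasurePreserving (fun p : ↥(adelicColRange n K a m) × ↥(adelicColRange n K (m + 1) b) =>
        (ℓ₀ * p.1, p.2)) (μL.prod μH) (μL.prod μH) :=
      (measurePreserving_mul_left μL ℓ₀).prod (MeasurePreserving.id μH)
    rw [hcomp, ← map_map he hmp.measurable, hmp.map_eq]
  -- invariance under the high factor (skew product)
  have hH : ∀ h₀ : ↥(adelicColRange n K (m + 1) b),
      ((μL.prod μH).map e).map ((⟨h₀, unipotentColRange_mono hab le_rfl h₀.2⟩ :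
        ↥(adelicColRange n K a b)) * ·) = (μL.prod μH).map e := by
    intro h₀
    rw [map_map (measurable_const_mul _) he]
    have hcomp : (((⟨h₀, unipotentColRange_mono hab le_rfl h₀.2⟩ : ↥(adelicColRange n K a b)) * ·) ∘ e) =
        e ∘ fun p => (p.1, lowConj m p.1 h₀ * p.2) := by
      funext p
      refine Subtype.ext ?_
      change (h₀ : GL (Fin n) (AdeleRing (𝓞 K) K)) * ((p.1 : GL (Fin n) (AdeleRing (𝓞 K) K)) * p.2) =
        (p.1 : GL (Fin n) (AdeleRing (𝓞 K) K)) *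
          ((p.1 : GL (Fin n) (AdeleRing (𝓞 K) K))⁻¹ * h₀ * p.1 * p.2)
      group
    have hmp : MeasurePreserving (fun p : ↥(adelicColRange n K a m) × ↥(adelicColRange n K (m + 1) b) =>
        (p.1, lowConj m p.1 h₀ * p.2)) (μL.prod μH) (μL.prod μH) := by
      refine (MeasurePreserving.id μL).skew_product (g := fun ℓ h => lowConj m ℓ h₀ * h) ?_ ?_
      · exact ((continuous_lowConj m h₀).comp continuous_fst).measurable.mul measurable_snd
      · exact Eventually.of_forall fun ℓ => (measurePreserving_mul_left μH (lowConj m ℓ h₀)).map_eq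
    rw [hcomp, ← map_map he hmp.measurable, hmp.map_eq]
  refine ⟨fun u => ?_⟩
  -- `u = h ℓ` with `h` high, `ℓ` low: `u · = h · ∘ ℓ ·`
  have hu := colSplit_mul m u.2
  set h : ↥(adelicColRange n K (m + 1) b) := ⟨colSplitHigh m (u : GL (Fin n) (AdeleRing (𝓞 K) K)),
    colSplitHigh_mem m u.2⟩
  set ℓ : ↥(adelicColRange n K a m) := ⟨colSplitLow m (u : GL (Fin n) (AdeleRing (𝓞 K) K)),
    colSplitLow_mem m u.2⟩
  have hsplit : (fun x : ↥(adelicColRange n K a b) => u * x) =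
      ((⟨h, unipotentColRange_mono hab le_rfl h.2⟩ : ↥(adelicColRange n K a b)) * ·) ∘
        ((⟨ℓ, unipotentColRange_mono le_rfl hmb ℓ.2⟩ : ↥(adelicColRange n K a b)) * ·) := by
    funext x
    refine Subtype.ext ?_
    change (u : GL (Fin n) (AdeleRing (𝓞 K) K)) * x =
      colSplitHigh m (u : GL (Fin n) (AdeleRing (𝓞 K) K)) * (colSplitLow m (u : GL (Fin n) (AdeleRing (𝓞 K) K)) * x)
    rw [← mul_assoc, hu]
  rw [hsplit, ← map_map (measurable_const_mul _) (measurable_const_mul _), hL ℓ, hH h]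

/-- **The image of `μ_H ⊗ μ_L` under `(h, ℓ) ↦ h ℓ` is a Haar measure on `U_{[a,b]}(𝔸_K)`.** The
semidirect order `(ℓ, h) ↦ ℓ h` gives a left Haar measure `ρ'` (`isMulLeftInvariant_map_low_mul_high`,
plus finiteness on compacts and positivity on opens along the homeomorphism); `U_{[a,b]}(𝔸_K)` is
unimodular, so `ρ'` is inversion invariant, and `(ℓ h)⁻¹ = h⁻¹ ℓ⁻¹` with `μ_H`, `μ_L` inversion
invariant shows that `ρ'` is also the image in the order `(h, ℓ) ↦ h ℓ`. [folklore] -/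
theorem isHaarMeasure_map_colSplitHomeomorph :
    IsHaarMeasure ((μH.prod μL).map (colSplitHomeomorph (n := n) (K := K) m hab hmb)) := by
  -- the semidirect-order measure `ρ'`
  set e' : ↥(adelicColRange n K a m) × ↥(adelicColRange n K (m + 1) b) → ↥(adelicColRange n K a b) :=
    fun p => ⟨(p.1 : GL (Fin n) (AdeleRing (𝓞 K) K)) * p.2,
      (adelicColRange n K a b).mul_mem (unipotentColRange_mono le_rfl hmb p.1.2)
        (unipotentColRange_mono hab le_rfl p.2.2)⟩ with he'_def
  have he'c : Continuous e' := by
    refine Continuous.subtype_mk ?_ _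
    exact (continuous_subtype_val.comp continuous_fst).mul (continuous_subtype_val.comp continuous_snd)
  have he' : Measurable e' := he'c.measurable
  -- `e'` is a homeomorphism too: `e' = colSplitHomeomorph ∘ swap ∘ (conj…)`? We only need that it is
  -- proper with dense... Instead we transport through the inversion identity directly.
  set E := colSplitHomeomorph (n := n) (K := K) m hab hmb with hE_def
  have hE : Measurable E := E.continuous.measurable
  haveI hρ'inv : ((μL.prod μH).map e').IsMulLeftInvariant := isMulLeftInvariant_map_low_mul_high m hab hmb μH μL
  -- `ρ'` is a Haar measure: finite on compacts and positive on opens, via `e' = E ∘ σ` with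
  -- `σ (ℓ, h) = (ℓ h ℓ⁻¹, ℓ)` a homeomorphism of the product
  let σ : ↥(adelicColRange n K a m) × ↥(adelicColRange n K (m + 1) b) ≃ₜ
      ↥(adelicColRange n K (m + 1) b) × ↥(adelicColRange n K a m) :=
    { toFun := fun p => (lowConj m p.1⁻¹ p.2, p.1)
      invFun := fun q => (q.2, lowConj m q.2 q.1)
      left_inv := fun p => by
        refine Prod.ext rfl (Subtype.ext ?_)
        change ((p.1 : GL (Fin n) (AdeleRing (𝓞 K) K)))⁻¹ *
          ((((p.1⁻¹ : ↥(adelicColRange n K a m)) : GL (Fin n) (AdeleRing (𝓞 K) K)))⁻¹ * p.2 * (p.1⁻¹ : ↥(adelicColRange n K a m))) * p.1 = p.2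
        simp only [Subgroup.coe_inv, inv_inv]
        group
      right_inv := fun q => by
        refine Prod.ext (Subtype.ext ?_) rfl
        change (((q.2⁻¹ : ↥(adelicColRange n K a m)) : GL (Fin n) (AdeleRing (𝓞 K) K)))⁻¹ *
          (((q.2 : GL (Fin n) (AdeleRing (𝓞 K) K)))⁻¹ * q.1 * q.2) * (q.2⁻¹ : ↥(adelicColRange n K a m)) = q.1
        simp only [Subgroup.coe_inv, inv_inv]
        group
      continuous_toFun := by
        refine Continuous.prodMk (Continuous.subtype_mk ?_ _) continuous_fst
        exact (((continuous_subtype_val.comp (continuous_fst.inv)).inv).mul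
          (continuous_subtype_val.comp continuous_snd)).mul (continuous_subtype_val.comp (continuous_fst.inv))
      continuous_invFun := by
        refine Continuous.prodMk continuous_snd (Continuous.subtype_mk ?_ _)
        exact (((continuous_subtype_val.comp continuous_snd).inv).mul
          (continuous_subtype_val.comp continuous_fst)).mul (continuous_subtype_val.comp continuous_snd) }
  have heσ : e' = E ∘ σ := by
    funext p
    refine Subtype.ext ?_
    change (p.1 : GL (Fin n) (AdeleRing (𝓞 K) K)) * p.2 =
      ((((p.1⁻¹ : ↥(adelicColRange n K a m)) : GL (Fin n) (AdeleRing (𝓞 K) K)))⁻¹ * p.2 * (p.1⁻¹ : ↥(adelicColRange n K a m))) * p.1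
    simp only [Subgroup.coe_inv, inv_inv]
    group
  have heHomeo : IsHomeomorph e' := by
    rw [heσ]
    exact E.isHomeomorph.comp σ.isHomeomorph
  haveI : IsHaarMeasure ((μL.prod μH).map e') := by
    refine { lt_top_of_isCompact := fun C hC => ?_, open_pos := fun U hU hne => ?_ }
    · rw [map_apply he' hC.measurableSet]
      exact ((heHomeo.homeomorph e').isCompact_preimage.2 hC).measure_lt_top
    · rw [map_apply he' hU.measurableSet]
      exact (hU.preimage he'c).measure_ne_zero _ (hne.preimage heHomeo.surjective)
  -- inversion: `ρ'` is inversion invariant, and `inv ∘ e' = E ∘ swap ∘ (inv × inv)`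
  haveI := isInvInvariant_of_isHaarMeasure_adelicColRange ((μL.prod μH).map e')
  haveI := isInvInvariant_of_isHaarMeasure_adelicColRange μH
  haveI := isInvInvariant_of_isHaarMeasure_adelicColRange μL
  have hinv : ((μL.prod μH).map e').inv = (μH.prod μL).map E := by
    rw [Measure.inv, map_map measurable_inv he']
    have hcomp : (Inv.inv ∘ e') = E ∘ (fun p : ↥(adelicColRange n K a m) × ↥(adelicColRange n K (m + 1) b) =>
        ((p.2⁻¹ : ↥(adelicColRange n K (m + 1) b)), (p.1⁻¹ : ↥(adelicColRange n K a m)))) := by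
      funext p
      refine Subtype.ext ?_
      change ((p.1 : GL (Fin n) (AdeleRing (𝓞 K) K)) * p.2)⁻¹ =
        (((p.2⁻¹ : ↥(adelicColRange n K (m + 1) b)) : GL (Fin n) (AdeleRing (𝓞 K) K))) * (p.1⁻¹ : ↥(adelicColRange n K a m))
      simp only [Subgroup.coe_inv, _root_.mul_inv_rev]
    have hmp : MeasurePreserving (fun p : ↥(adelicColRange n K a m) × ↥(adelicColRange n K (m + 1) b) =>
        ((p.2⁻¹ : ↥(adelicColRange n K (m + 1) b)), (p.1⁻¹ : ↥(adelicColRange n K a m)))) (μL.prod μH) (μH.prod μL) := by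
      have h1 : MeasurePreserving (fun p : ↥(adelicColRange n K a m) × ↥(adelicColRange n K (m + 1) b) =>
          (p.1⁻¹, p.2⁻¹)) (μL.prod μH) (μL.prod μH) :=
        (measurePreserving_inv μL).prod (measurePreserving_inv μH)
      have h2 : MeasurePreserving (Prod.swap : ↥(adelicColRange n K a m) × ↥(adelicColRange n K (m + 1) b) →
          ↥(adelicColRange n K (m + 1) b) × ↥(adelicColRange n K a m)) (μL.prod μH) (μH.prod μL) :=
        measurePreserving_swap
      exact h2.comp h1
    rw [hcomp, ← map_map hE hmp.measurable, hmp.map_eq]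
  rw [← hinv, Measure.inv, Measure.map_inv_eq_self]
  infer_instance

/-- **Integration in split coordinates.** For every Haar measure `ν` on `U_{[a,b]}(𝔸_K)` there is
`c ∈ (0, ∞)` with `∫ f dν = c ∫_{U_{[m+1,b]}} ∫_{U_{[a,m]}} f(h ℓ) dμ_L(ℓ) dμ_H(h)` for all measurable
`f ≥ 0` (uniqueness of Haar measure, then Tonelli). [folklore] -/
theorem lintegral_adelicColRange_eq_mul_lintegral_prod (ν : Measure ↥(adelicColRange n K a b))
    [IsHaarMeasure ν] :
    ∃ c : ℝ≥0∞, c ≠ 0 ∧ c ≠ ∞ ∧ ∀ f : ↥(adelicColRange n K a b) → ℝ≥0∞, Measurable f →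
      ∫⁻ u, f u ∂ν = c * ∫⁻ h, ∫⁻ ℓ, f (colSplitHomeomorph (n := n) (K := K) m hab hmb (h, ℓ)) ∂μL ∂μH := by
  haveI := isHaarMeasure_map_colSplitHomeomorph m hab hmb μH μL
  set E := colSplitHomeomorph (n := n) (K := K) m hab hmb with hE_def
  have hE : Measurable E := E.continuous.measurable
  refine ⟨haarScalarFactor ν ((μH.prod μL).map E), ?_, ENNReal.coe_ne_top, fun f hf => ?_⟩
  · exact_mod_cast (haarScalarFactor_pos_of_isHaarMeasure ν ((μH.prod μL).map E)).ne'
  · have hν : ν = haarScalarFactor ν ((μH.prod μL).map E) • (μH.prod μL).map E :=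
      isMulLeftInvariant_eq_smul ν _
    calc ∫⁻ u, f u ∂ν
        = ∫⁻ u, f u ∂(haarScalarFactor ν ((μH.prod μL).map E) • (μH.prod μL).map E) := by rw [← hν]
      _ = haarScalarFactor ν ((μH.prod μL).map E) * ∫⁻ p, (f ∘ E) p ∂(μH.prod μL) := by
          rw [lintegral_smul_measure, lintegral_map hf hE]
          rfl
      _ = haarScalarFactor ν ((μH.prod μL).map E) * ∫⁻ h, ∫⁻ ℓ, f (E (h, ℓ)) ∂μL ∂μH := by
          rw [lintegral_prod _ (hf.comp hE).aemeasurable]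
          rfl

/-- **The measure of the box factors**: `ν(box_{[a,b]}) = c μ_H(box_{[m+1,b]}) μ_L(box_{[a,m]})` with the
same constant `c` (the box is the image of the product of the boxes). [folklore] -/
theorem measure_colRangeTateDomain_eq_mul (ν : Measure ↥(adelicColRange n K a b)) [IsHaarMeasure ν] :
    ∃ c : ℝ≥0∞, c ≠ 0 ∧ c ≠ ∞ ∧
      (∀ f : ↥(adelicColRange n K a b) → ℝ≥0∞, Measurable f →
        ∫⁻ u, f u ∂ν = c * ∫⁻ h, ∫⁻ ℓ, f (colSplitHomeomorph (n := n) (K := K) m hab hmb (h, ℓ)) ∂μL ∂μH) ∧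
      ν (colRangeTateDomain n K a b) =
        c * (μH (colRangeTateDomain n K (m + 1) b) * μL (colRangeTateDomain n K a m)) := by
  obtain ⟨c, hc0, hc, hint⟩ := lintegral_adelicColRange_eq_mul_lintegral_prod m hab hmb μH μL ν
  refine ⟨c, hc0, hc, hint, ?_⟩
  set E := colSplitHomeomorph (n := n) (K := K) m hab hmb with hE_def
  have hmeas : MeasurableSet (colRangeTateDomain n K a b) := measurableSet_colRangeTateDomain
  rw [← lintegral_indicator_one hmeas, hint _ (measurable_one.indicator hmeas)]
  congr 1
  have hpre : E ⁻¹' colRangeTateDomain n K a b =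
      colRangeTateDomain n K (m + 1) b ×ˢ colRangeTateDomain n K a m := by
    rw [← image_colSplitHomeomorph_prod m hab hmb, ← hE_def]
    exact E.injective.preimage_image _
  have hind : ∀ h ℓ, (colRangeTateDomain n K a b).indicator (1 : ↥(adelicColRange n K a b) → ℝ≥0∞) (E (h, ℓ)) =
      (colRangeTateDomain n K (m + 1) b).indicator 1 h * (colRangeTateDomain n K a m).indicator 1 ℓ := by
    intro h ℓ
    have hmem : E (h, ℓ) ∈ colRangeTateDomain n K a b ↔
        h ∈ colRangeTateDomain n K (m + 1) b ∧ ℓ ∈ colRangeTateDomain n K a m := by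
      rw [← Set.mem_preimage, hpre, Set.mem_prod]
    by_cases h1 : h ∈ colRangeTateDomain n K (m + 1) b <;> by_cases h2 : ℓ ∈ colRangeTateDomain n K a m
    · rw [Set.indicator_of_mem (hmem.2 ⟨h1, h2⟩), Set.indicator_of_mem h1, Set.indicator_of_mem h2]
      simp
    · rw [Set.indicator_of_notMem (fun hm => h2 (hmem.1 hm).2), Set.indicator_of_notMem h2, mul_zero]
    · rw [Set.indicator_of_notMem (fun hm => h1 (hmem.1 hm).1), Set.indicator_of_notMem h1, zero_mul]
    · rw [Set.indicator_of_notMem (fun hm => h1 (hmem.1 hm).1), Set.indicator_of_notMem h1, zero_mul]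
  simp_rw [hind]
  have hmH : MeasurableSet (colRangeTateDomain n K (m + 1) b) := measurableSet_colRangeTateDomain
  have hmL : MeasurableSet (colRangeTateDomain n K a m) := measurableSet_colRangeTateDomain
  calc ∫⁻ h, ∫⁻ ℓ, (colRangeTateDomain n K (m + 1) b).indicator 1 h *
          (colRangeTateDomain n K a m).indicator (1 : ↥(adelicColRange n K a m) → ℝ≥0∞) ℓ ∂μL ∂μH
      = ∫⁻ h, (colRangeTateDomain n K (m + 1) b).indicator 1 h * μL (colRangeTateDomain n K a m) ∂μH := by
        refine lintegral_congr fun h => ?_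
        rw [lintegral_const_mul _ (measurable_one.indicator hmL), lintegral_indicator_one hmL]
    _ = μH (colRangeTateDomain n K (m + 1) b) * μL (colRangeTateDomain n K a m) := by
        rw [lintegral_mul_const _ (measurable_one.indicator hmH), lintegral_indicator_one hmH]

/-- The product `ℓ h ∈ U_{[a,b]}(𝔸_K)` of `h ∈ U_{[m+1,b]}`, `ℓ ∈ U_{[a,m]}` — the swapped order.
[folklore] -/
def lowMulHigh (p : ↥(adelicColRange n K (m + 1) b) × ↥(adelicColRange n K a m)) :
    ↥(adelicColRange n K a b) :=
  ⟨(p.2 : GL (Fin n) (AdeleRing (𝓞 K) K)) * p.1,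
    (adelicColRange n K a b).mul_mem (unipotentColRange_mono le_rfl hmb p.2.2)
      (unipotentColRange_mono hab le_rfl p.1.2)⟩

omit [MeasurableSpace (GL (Fin n) (AdeleRing (𝓞 K) K))] [BorelSpace (GL (Fin n) (AdeleRing (𝓞 K) K))] in
/-- The underlying matrix of `lowMulHigh (h, ℓ)` is `ℓ h` (definitional). [folklore] -/
@[simp]
theorem coe_lowMulHigh (p : ↥(adelicColRange n K (m + 1) b) × ↥(adelicColRange n K a m)) :
    ((lowMulHigh (n := n) (K := K) m hab hmb p : ↥(adelicColRange n K a b)) : GL (Fin n) (AdeleRing (𝓞 K) K)) =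
      (p.2 : GL (Fin n) (AdeleRing (𝓞 K) K)) * p.1 := rfl

omit [MeasurableSpace (GL (Fin n) (AdeleRing (𝓞 K) K))] [BorelSpace (GL (Fin n) (AdeleRing (𝓞 K) K))] in
/-- `(h ℓ)⁻¹ = ℓ⁻¹ h⁻¹`: inversion intertwines the two orders. [folklore] -/
theorem colSplitHomeomorph_inv (p : ↥(adelicColRange n K (m + 1) b) × ↥(adelicColRange n K a m)) :
    (colSplitHomeomorph (n := n) (K := K) m hab hmb p)⁻¹ = lowMulHigh m hab hmb (p.1⁻¹, p.2⁻¹) := by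
  refine Subtype.ext ?_
  change ((p.1 : GL (Fin n) (AdeleRing (𝓞 K) K)) * p.2)⁻¹ =
    (((p.2⁻¹ : ↥(adelicColRange n K a m))) : GL (Fin n) (AdeleRing (𝓞 K) K)) *
      ((p.1⁻¹ : ↥(adelicColRange n K (m + 1) b)) : GL (Fin n) (AdeleRing (𝓞 K) K))
  rw [_root_.mul_inv_rev, Subgroup.coe_inv, Subgroup.coe_inv]

/-- **Integration in split coordinates, swapped order.** With the same constant `c` as in
`lintegral_adelicColRange_eq_mul_lintegral_prod` one also has
`∫ f dν = c ∫_{U_{[m+1,b]}} ∫_{U_{[a,m]}} f(ℓ h) dμ_L(ℓ) dμ_H(h)`: apply the `(h ℓ)`-order formula to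
`u ↦ f(u⁻¹)` and use the inversion invariance of the three (unimodular) Haar measures,
`(h ℓ)⁻¹ = ℓ⁻¹ h⁻¹`. [folklore] -/
theorem lintegral_adelicColRange_eq_mul_lintegral_prod_swap (ν : Measure ↥(adelicColRange n K a b))
    [IsHaarMeasure ν] :
    ∃ c : ℝ≥0∞, c ≠ 0 ∧ c ≠ ∞ ∧
      (∀ f : ↥(adelicColRange n K a b) → ℝ≥0∞, Measurable f →
        ∫⁻ u, f u ∂ν = c * ∫⁻ h, ∫⁻ ℓ, f (colSplitHomeomorph (n := n) (K := K) m hab hmb (h, ℓ)) ∂μL ∂μH) ∧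
      (∀ f : ↥(adelicColRange n K a b) → ℝ≥0∞, Measurable f →
        ∫⁻ u, f u ∂ν = c * ∫⁻ h, ∫⁻ ℓ, f (lowMulHigh (n := n) (K := K) m hab hmb (h, ℓ)) ∂μL ∂μH) ∧
      ν (colRangeTateDomain n K a b) =
        c * (μH (colRangeTateDomain n K (m + 1) b) * μL (colRangeTateDomain n K a m)) := by
  obtain ⟨c, hc0, hc, hint, hvol⟩ := measure_colRangeTateDomain_eq_mul m hab hmb μH μL ν
  refine ⟨c, hc0, hc, hint, fun f hf => ?_, hvol⟩
  haveI : ν.IsInvInvariant := isInvInvariant_of_isHaarMeasure_adelicColRange ν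
  haveI : μH.IsInvInvariant := isInvInvariant_of_isHaarMeasure_adelicColRange μH
  haveI : μL.IsInvInvariant := isInvInvariant_of_isHaarMeasure_adelicColRange μL
  -- `∫ f = ∫ f ∘ inv`
  have h1 : ∫⁻ u, f u ∂ν = ∫⁻ u, f u⁻¹ ∂ν :=
    ((measurePreserving_inv ν).lintegral_comp_emb (MeasurableEquiv.inv _).measurableEmbedding f).symm
  have h3 := hint (fun u => f u⁻¹) (hf.comp measurable_inv)
  simp only [colSplitHomeomorph_inv] at h3
  rw [h1, h3]
  congr 1
  -- `∫_H ∫_L f(ℓ⁻¹ h⁻¹) = ∫_H ∫_L f(ℓ h⁻¹) = ∫_H ∫_L f(ℓ h)`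
  have h2 : ∀ h : ↥(adelicColRange n K (m + 1) b),
      ∫⁻ ℓ, f (lowMulHigh (n := n) (K := K) m hab hmb (h⁻¹, ℓ⁻¹)) ∂μL =
        ∫⁻ ℓ, f (lowMulHigh (n := n) (K := K) m hab hmb (h⁻¹, ℓ)) ∂μL := fun h =>
    (measurePreserving_inv μL).lintegral_comp_emb (MeasurableEquiv.inv _).measurableEmbedding
      (fun ℓ => f (lowMulHigh (n := n) (K := K) m hab hmb (h⁻¹, ℓ)))
  simp_rw [h2]
  exact (measurePreserving_inv μH).lintegral_comp_emb (MeasurableEquiv.inv _).measurableEmbedding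
    (fun h : ↥(adelicColRange n K (m + 1) b) => ∫⁻ ℓ, f (lowMulHigh (n := n) (K := K) m hab hmb (h, ℓ)) ∂μL)

end Measure

end Adelic

end Literature.NumberTheory.Automorphic
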